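import Summits.AtomisticToContinuum.HydrodynamicLimit.Theorems.LambertianContactSwapLambertianEulerOfHeartsInBand
import Summits.AtomisticToContinuum.HydrodynamicLimit.Theorems.LambertianContactSwapLambertianEulerEstimateOfHeartsLog
import Summits.AtomisticToContinuum.HydrodynamicLimit.Theorems.LambertianContactSwapLambertianEulerDockRfInBand
import Summits.AtomisticToContinuum.HydrodynamicLimit.Theorems.LambertianContactSwapLambertianEulerEntropyToHydro
import Summits.AtomisticToContinuum.HydrodynamicLimit.Theses.LambertianContactSwap
import Summits.AtomisticToContinuum.HydrodynamicLimit.Theses.LindebergRandomFuture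
import Summits.AtomisticToContinuum.HydrodynamicLimit.Theses.ImplosionDichotomy
import HarnessLib

/-!
# `LambertianEulerInBand` from the two log-shell hearts alone; the unguarded crux from it and dilute self-consistency (line `Sketch`, crux stmt-11854)

Support file (`--supports stmt-AtomisticToContinuum-11854`) recording IN THE TREE the reshaped composition of the registered skeleton
`Cruxes/LambertianEuler/Lines/Sketch.lean` (v35, lead c7):

* `lambertianEulerInBand_of_hearts : KineticOneBlockInMeanLambdaLog → CollisionalOneBlockInMeanLambdaLog → LambertianEulerInBand`
  — the PACKING-GUARDED Euler limit of the Lambertian gas (the crux in the shape of the re-typed conjunct, D-0032) from the two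
  research hearts ONLY: guarded ESTIMATE (`…EstimateOfHeartsLog`) ⇒ BOUND ⇒ STEP ⇒ GRONWALL (`…OfHeartsInBand`) ⇒ guarded Rf-dock
  (`…DockRfInBand`, p137924) ⇒ entropy→hydro glue (`tendsto_lambertFields_of_klDiv`, p106285).  No `DiluteSelfConsistency`
  (stmt-3091, expected false by its own chain) anywhere in the cone.
* `lambertianEuler_of_inBand : LambertianEulerInBand → ImplosionDichotomy.DiluteSelfConsistency → LambertianContactSwap.LambertianEuler`
  (ten lines: dilute self-consistency at the band `η₀` discharges the guard) and hence `lambertianEuler_of_heartsLog`, the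
  composition the registered skeleton v35 uses for the crux AS TYPED (unguarded); the guarded statement is trivially WEAKER than
  the crux as typed (take any band, ignore the guard).
Recommendation to the planner (release note): re-type the crux `LambertianEuler` with the conjunct's packing guard; it then closes from
the two log-hearts by `lambertianEulerInBand_of_hearts` and a five-line file.  Lead prover-line-stmt-AtomisticToContinuum-11854-c7-0,
2026-08-17.  [cite: Yau1991, §2] [cite: OllaVaradhanYau1993, §3–§4]
-/

noncomputable section

namespace Summit.AtomisticToContinuum.HydrodynamicLimit.Theorems.LambertianContactSwapLambertianEulerInBandOfHearts

open scoped BigOperators Topology ENNReal InnerProductSpace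
open MeasureTheory ProbabilityTheory Filter Set InformationTheory
open Literature.MathematicalPhysics.KineticTheory
open Literature.Analysis.FluidPDE Literature.Analysis.FluidPDE.Alexander
open Summit.AtomisticToContinuum.HydrodynamicLimit.Theorems.LambertianContactSwapLambertianEulerHearts
open Summit.AtomisticToContinuum.HydrodynamicLimit.Theorems.LambertianContactSwapLambertianEulerHeartsLog
open Summit.AtomisticToContinuum.HydrodynamicLimit.Theorems.LambertianContactSwapLambertianEulerEstimateOfHeartsLog
open Summit.AtomisticToContinuum.HydrodynamicLimit.Theorems.LambertianContactSwapLambertianEulerOfHeartsInBand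
open Summit.AtomisticToContinuum.HydrodynamicLimit.Theorems.LambertianContactSwapLambertianEulerEntropyToHydro

/-! ## §1 The guarded entropy→hydro glue -/

/-- **`RelEntropyVanishingLambda`, packing-guarded ⇒ `LambertianEulerInBand`**: the entropy-inequality glue of the relative-entropy
method for the Lambertian gas (`tendsto_lambertFields_of_klDiv` at each `t < T`; `σ₀` capped at `1/2`, where `Λ` is measurable), with
the packing guard threaded through. [cite: Yau1991, §2] [cite: KipnisLandim1999, Ch. 6 §1] -/
theorem lambertianEulerInBand_of_relEntropyVanishingInBand
    (hRE : ∃ η₀ : ℝ, 0 < η₀ ∧ ∀ (a₀ θ₀ : T3 → ℝ) (u₀ : T3 → V3), Continuous a₀ → Continuous θ₀ → Continuous u₀ → (∀ x, 0 < a₀ x) → (∀ x, 0 < θ₀ x) → ∃ σ₀ : ℝ, 0 < σ₀ ∧ ∀ σ : ℝ, 0 < σ → σ < σ₀ → ∀ (T : ℝ) (ρ θ : ℝ → T3 → ℝ) (u : ℝ → T3 → V3), IsHardSphereEulerSolution σ T ρ u θ → (∀ t ∈ Set.Ico 0 T, ∀ x, ρ t x * σ ^ 3 < η₀) → ∀ Φ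 : (N : ℕ) → HardSphereFlow (Torus.geometry (Fin 3)) (hsDiameter σ N) (N + 1), (∀ N, IsProbabilityMeasure (localGibbsLaw σ a₀ u₀ θ₀ N (Φ N))) ∧ (TendstoHydroFieldsAt (fun N => localGibbsLaw σ a₀ u₀ θ₀ N (Φ N)) Φ ρ u θ 0 → ∀ t ∈ Set.Ico 0 T, ∃ a : T3 → ℝ, (∀ N, IsProbabilityMeasure (localGibbsLaw σ a (u t) (θ t) N (Φ N))) ∧ (∀ χ : T3 → ℝ, Continuous χ → ∀ δ : ℝ, 0 < δ → ∃ C : ℝ, 0 < C ∧ ∀ N : ℕ, localGibbsLaw σ a (u t) (θ t) N (Φ N) {z | δ < |empiricalDensityField z χ - ∫ x, χ x * ρ t x|} ≤ ENNReal.ofReal (C * Real.exp (-(C⁻¹ * (N + 1)))) ∧ localGibbsLaw σ a (u t) (θ t) N (Φ N) {z | δ < ‖empiricalMomentumField z χ - ∫ x, (χ x * ρ t x) • u t x‖} ≤ ENNReal.ofReal (C * Real.exp (-(C⁻¹ * (N + 1)))) ∧ localGibbsLaw σ a (u t) (θ t) N (Φ N) {z | δ < |empiricalEnergyField z χ - ∫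 x, χ x * totalEnergyDensity (ρ t x) (u t x) (θ t x)|} ≤ ENNReal.ofReal (C * Real.exp (-(C⁻¹ * (N + 1))))) ∧ Tendsto (fun N : ℕ => klDiv (((localGibbsLaw σ a₀ u₀ θ₀ N (Φ N)).prod (lambertNoise (Fin 3))).map (fun p => lambertFlow (Torus.geometry (Fin 3)) (hsDiameter σ N) p.2 p.1 t)) (localGibbsLaw σ a (u t) (θ t) N (Φ N)) / ((N : ℝ≥0∞) + 1)) atTop (𝓝 0))) : LambertianEulerInBand := by
  obtain ⟨η₀, hη₀, H⟩ := hRE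
  refine ⟨η₀, hη₀, fun a₀ θ₀ u₀ ha hθ hu ha0 hθ0 => ?_⟩
  obtain ⟨σ₀, hσ₀, H⟩ := H a₀ θ₀ u₀ ha hθ hu ha0 hθ0
  refine ⟨min σ₀ 2⁻¹, lt_min hσ₀ (by norm_num), fun σ hσ hσ' T ρ θ u hE hg Φ h0 t ht χ hχ δ hδ => ?_⟩
  have hσ₁ : σ < σ₀ := hσ'.trans_le (min_le_left _ _)
  have hσ₂ : σ < 2⁻¹ := hσ'.trans_le (min_le_right _ _)
  obtain ⟨hprob, hmain⟩ := H σ hσ hσ₁ T ρ θ u hE hg Φ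
  obtain ⟨a, hψ, hconc, hkl⟩ := hmain h0 t ht
  exact tendsto_lambertFields_of_klDiv (a := a) hσ.le hσ₂ Φ hconc hkl χ hχ δ hδ

/-! ## §2 The guarded crux from the two log-hearts -/

/-- **THE REDUCTION OF THE GUARDED CRUX TO THE TWO HEARTS.** `LambertianEulerInBand` follows from the kinetic log-heart P3Λ-log and
the collisional log-heart P4Λ-log alone: entropy→hydro ∘ guarded Rf-dock (p137924) ∘ guarded GRONWALL ∘ WINDOW STEP ∘ BOUND ∘
ESTIMATE ∘ log-hearts — no dilute self-consistency. [cite: Yau1991, §2] [cite: OllaVaradhanYau1993, §3–§4] -/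
theorem lambertianEulerInBand_of_hearts : Summit.AtomisticToContinuum.HydrodynamicLimit.Theorems.LambertianContactSwapLambertianEulerHeartsLog.KineticOneBlockInMeanLambdaLog → Summit.AtomisticToContinuum.HydrodynamicLimit.Theorems.LambertianContactSwapLambertianEulerHeartsLog.CollisionalOneBlockInMeanLambdaLog → Summit.AtomisticToContinuum.HydrodynamicLimit.Theorems.LambertianContactSwapLambertianEulerHeartsLog.LambertianEulerInBand :=
  fun h3 h4 =>
  lambertianEulerInBand_of_relEntropyVanishingInBand
    (Summit.AtomisticToContinuum.HydrodynamicLimit.Theorems.LambertianContactSwapLambertianEulerDockRfInBand.stub_dockLambdaRfInBand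
      (gronwallRfLambdaInBand_of_windowStep
        (windowStepLambdaInBand_of_bound
          (windowProductionBoundLambdaInBand_of_estimate
            (windowProductionEstimateLambdaInBand_of_heartsLog h3 h4)))))

/-- The old-shell hearts (lead c5/c6's `KineticOneBlockInMeanLambda` / `CollisionalOneBlockInMeanLambda`) also give the guarded crux,
through `…Log_of` — i.e. lead c6's reduction with its third premise `DiluteSelfConsistency` REMOVED. [cite: Yau1991, §2] -/
theorem lambertianEulerInBand_of_oldHearts (h3 : KineticOneBlockInMeanLambda) (h4 : CollisionalOneBlockInMeanLambda) :
    LambertianEulerInBand :=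
  lambertianEulerInBand_of_hearts (kineticOneBlockInMeanLambdaLog_of h3) (collisionalOneBlockInMeanLambdaLog_of h4)

/-! ## §3 The crux as typed (unguarded) from the guarded one and dilute self-consistency -/

/-- **`LambertianEulerInBand` + `DiluteSelfConsistency` ⇒ the crux as typed**: dilute self-consistency at the band `η₀` discharges
the packing guard (the ONLY use the line ever made of stmt-3091). [folklore] -/
theorem lambertianEuler_of_inBand (h : LambertianEulerInBand)
    (hS : Summit.AtomisticToContinuum.HydrodynamicLimit.Theses.ImplosionDichotomy.DiluteSelfConsistency) :
    Summit.AtomisticToContinuum.HydrodynamicLimit.Theses.LambertianContactSwap.LambertianEuler := by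
  obtain ⟨η₀, hη₀, H⟩ := h
  delta Summit.AtomisticToContinuum.HydrodynamicLimit.Theses.LambertianContactSwap.LambertianEuler
  intro Cfg G ε τ S ldir lpair lstep lstate linst lflow noise a₀ θ₀ u₀ ha hθ hu ha0 hθ0
  obtain ⟨σ₀, hσ₀, H⟩ := H a₀ θ₀ u₀ ha hθ hu ha0 hθ0
  obtain ⟨σd, hσd, Hd⟩ := hS η₀ hη₀ a₀ θ₀ u₀ ha hθ hu ha0 hθ0
  refine ⟨min σ₀ σd, lt_min hσ₀ hσd, fun σ hσ hσ' T ρ θ u hE Φ h0 t ht χ hχ δ hδ => ?_⟩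
  have hσ₁ : σ < σ₀ := hσ'.trans_le (min_le_left _ _)
  have hσ₂ : σ < σd := hσ'.trans_le (min_le_right _ _)
  exact H σ hσ hσ₁ T ρ θ u hE (fun t' ht' x => Hd σ hσ hσ₂ T ρ θ u hE Φ h0 t' ht' x) Φ h0 t ht χ hχ δ hδ

/-- The same for the sister route's copy `LindebergRandomFuture.LambertianEuler` (byte-identical body). [folklore] -/
theorem lindebergRandomFuture_lambertianEuler_of_inBand (h : LambertianEulerInBand)
    (hS : Summit.AtomisticToContinuum.HydrodynamicLimit.Theses.ImplosionDichotomy.DiluteSelfConsistency) :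
    Summit.AtomisticToContinuum.HydrodynamicLimit.Theses.LindebergRandomFuture.LambertianEuler :=
  lambertianEuler_of_inBand h hS

/-- **The composition of the registered skeleton v35**: the crux as typed from the two log-hearts and stmt-3091.
[cite: Yau1991, §2] -/
theorem lambertianEuler_of_heartsLog (h3 : KineticOneBlockInMeanLambdaLog) (h4 : CollisionalOneBlockInMeanLambdaLog)
    (hS : Summit.AtomisticToContinuum.HydrodynamicLimit.Theses.ImplosionDichotomy.DiluteSelfConsistency) :
    Summit.AtomisticToContinuum.HydrodynamicLimit.Theses.LambertianContactSwap.LambertianEuler :=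
  lambertianEuler_of_inBand (lambertianEulerInBand_of_hearts h3 h4) hS

end Summit.AtomisticToContinuum.HydrodynamicLimit.Theorems.LambertianContactSwapLambertianEulerInBandOfHearts
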